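import Summits.QuantumFields.YangMills.Theorems.BalabanUVNodesN07NormalisationDbarFramesExists
import Summits.QuantumFields.YangMills.Theorems.BalabanUVNodesN07NormalisationDbarFramesWide
import HarnessLib

/-!
# N07 [B11] (= [15]) Sect. F — CERTIFICATE (C1)∕(C2) FOR THE WINDOW-FAMILY TEXT `NrmDbarWideOfRecord` (MODULE 91″): MODULE 92b's three record-level corollaries re-keyed at the
# window family `D̃ = (□̃-tower) ⊓ Ω(s)` — the generic §1 of 92b (`exists_cellConst_gauge`, `clause_of_cellConst`, `exists_frameLift_of_framesSU`) applies to ANY `Domains`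

Cell `pub-ymgap`, seat `pub-ymgap-dag-n07-e` g27 (typed) ∕ g28 (filed) (FAN-OUT §N07 row s3; LANE OWNER of the K0 road), MODULE 92c (INTENT-92c, cell bus; dag-lead GO, plan g92 A3⁗-W).
`--kind proof --supports stmt-QuantumFields-20541 --as helper` (K0⁷); count-neutral; THEOREMS ONLY (0 `def`).  [3] = [Balaban1985Averaging]; [6] = [Balaban1985RegularSpaces]; [15] = [Balaban1985Variational]; [I] = [Balaban1987RG1]; [PropII] = [Balaban1984PropagatorsII].

WHY.  ⚑ LOCATED-OUT-END-FRAME's cure (α⁗-W) moves the normalisation of record to the cells of the window family (MODULE 91″); plan RULING A3⁗ makes a `Nrm` text effective on its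
inhabitation certificate.  MODULE 92b proved the certificate generically in the family; this file instantiates it at `D̃`.

WHAT IS PROVED (sorry-free; axioms standard).  ★★★ `NrmDbarWideOfRecord.exists_of_frameLift` ((C1) from a frame lift on the cells of `D̃`), ★★★ `NrmDbarWideOfRecord.exists_of_framesSU`
((C1) from special-unitarity of the frames of `(U^{h̄·w})♮` on the `Ω̃`-blocks), ★★★ `NrmDbarWideOfRecord.exists_of_reads` ((C2): from the near-flatness reads under the `Ω̃`-blocks with the
budgets `8·3800·ℓ²·L^{i+1}·s₀ ≤ 1`, `8ℓ·L^{i+1}·s₀ ≤ θ < δ_N`; special-unitarity by k0-s1-w1 ★★`suN_vframeU_dbarIterU` BY NAME).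
TYPING GUARDS (plan g92, A3⁗-W; answered here for 91″ + 92c).  (g1) FIT: the window family needs NO fit inequality to be a `Domains` — `cubeDomains` is one for EVERY corner ∕ side
(its level sets are the cover-images `π_l '' □̃_l^{(l)}` of label boxes), and its (2.2)-admissibility `Adm22 D̃ R (L·M_h)` is `N07MeetFamilyAtRecord.adm22_meetCube_trunc_seqOfRecord` at
`a := cornerP − ρ`, `M′ := sideP + 2ρ`, which asks ONLY the grid divisibilities `L·M_h ∣ ρ`, `L·M_h ∣ a_i`, `L·M_h ∣ M′`, `L·M_h ∣ sitesPerDir j` and the collar `R·L·M_h ≤ ρ` — no size bound.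
The one SIZE condition the rows of record read is the NON-WRAPPING of print's window `□̃ = [tLo, tHi] = [cornerP − 2ρ, cornerP + sideP − 1 + 2ρ]` ([6] p. 98), which IS the top cube of
`D̃`'s tower: MODULES 62″∕75∕80's displayed `tHi κ ≤ tLo κ + n₀`, `n₀ + 1 < sitesPerDir j` (the K0 assembler's numerics; [6] (1.131) p. 99, [15] (144) p. 300: «□̃ ⊂ Ω_{k−1}»,
the (2.2) `R₁M₁`-collar).  (g2) ALIGNMENT: `Pt = Fin d → ℤ`, so `cornerP − ρ` is honest subtraction; `L·M_h ∣ cornerP_i` and `L·M_h ∣ ρ` give `L·M_h ∣ cornerP_i − ρ` (`dvd_sub`) and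
`L·M_h ∣ sideP + 2ρ` (`dvd_add`, `dvd_mul_of_dvd_right`) — the widened tower stays on the `L·M_h`-grid, so `Adm22 D̃` is the landed theorem verbatim.  (g3) «the cells of `D̃` that are
`D̃`-deep-adjacent touch no near-class bond» is MODULE 93's named lemma (every near-class constraint bond of `D″` is a constraint bond of `D̃`).
HONEST SCOPE: a satisfiability certificate (pure algebra + one landed SU(N) frame lemma); the reads are HYPOTHESES (the record's small-field guard); K0⁷ NOT closed; N07 NOT discharged; one
finite 𝕋⁴ programme at fixed ε — the route closes the conditional finite-𝕋⁴ rung `BalabanLadder.UV` ONLY; the YM mass gap (Clay) is NOT proved by any of this; nothing continuum ∕ ℝ⁴ ∕ OS.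
No `def`, no `instance`, no `notation`, no `sorry`.

References: [3] (87) p. 31, (92) p. 31, (97) p. 32, (110) p. 34, Prop. 4 (134)–(135) p. 38; [PropII] (2.1)–(2.4) p. 224; [15] (144) p. 300, (150)–(154) pp. 301–302; [6] p. 98, (1.29) p. 81, (1.131) p. 99; [I] (0.6), (0.9), (0.11) p. 253.
-/

set_option autoImplicit false

noncomputable section

open scoped Matrix.Norms.L2Operator

namespace Summit.QuantumFields.YangMills.BalabanUVNodes.N07NormalisationDbarFramesWideExists

open Literature.MathematicalPhysics.QuantumFieldTheory.Balaban1983to89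
open Literature.MathematicalPhysics.QuantumFieldTheory.Balaban1983to89.Node00
open T4Continuum (T4Family)
open ExpMeanLog (deltaSU)
open T4AxialGaugeRooted (axialGaugeAt)
open B12GaugeOrbits021 (IsResidual)
open B15Eq177GaugeInvariance (blockLift)
open B16Sect1Backgrounds (toMS)
open B14DomainGeom (Pt)
open B6SectADomainsV1 (Domains)
open B8Eq131Cubes (tLo tHi ctr)
open GaugeField (gaugeAct)
open B5Eq118OneStroke (iterBlockOf)
open B10Eq27TorusAxialLog (unitsField toUField suIncl gaugeActT val_unitsField)
open Summit.QuantumFields.Balaban3D.Carriers (radialContourData)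
open Summit.QuantumFields.YangMills.Theorems.Prop8ChartDoubleBar (vframeU dbarIterU)
open Summit.QuantumFields.YangMills.Theorems.K0Stub1DoubleBarFramesSU (suN_vframeU_dbarIterU)
open Summit.QuantumFields.YangMills.BalabanUVNodes.N07NormalisationDbarFrames (toUT)
open Summit.QuantumFields.YangMills.BalabanUVNodes.N07NormalisationDbarFramesWide (NrmDbarWideOfRecord)
open Summit.QuantumFields.YangMills.BalabanUVNodes.N07NormalisationDbarFramesExists (exists_cellConst_gauge clause_of_cellConst exists_frameLift_of_framesSU suN_unitsField_toUField)

variable {N : ℕ} [NeZero N]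

/-! ## §1  The certificate at the record, window family -/

section Record

variable {F : T4Family}

/-- ★★★ **(C1) `NrmDbarWideOfRecord` IS INHABITED, FROM A FRAME LIFT ON THE CELLS**: for the datum `(j, idx)`, the minimiser `U`, a residual `w` of level `j` with `U^{w}` radial-axial below
`j`, `h̄ :=` the block lift of the top axial gauge of `M^{j}(U^{w})` on print's window, `X := ((U^{w})^{h̄})♮ = (U^{h̄·w})♮`, `Ṽ` the accumulated frames of `X`, and an `SU(N)`-lift `sL` of `Ṽ`
on the cells of the WINDOW family `D̃ = □̃ ∩ Ω(s)`:  there is a gauge `u` (explicitly `u = g·(h̄·w)`, `g` the cell-constant gauge of `sL`) with `NrmDbarWideOfRecord … s U j idx u A`.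
[cite: Balaban1985Averaging, (87) p.31, (92) p.31, (97) p.32; Balaban1985Variational, (150)–(154) pp.301–302; Balaban1985RegularSpaces, (1.29) p.81; Balaban1987RG1, (0.6), (0.11) p.253] -/
theorem NrmDbarWideOfRecord.exists_of_frameLift {Mc ρ : ℕ} {ν : Stage7Numerics} {M : ℕ} {g : ℕ → ℝ} {K k : ℕ} (s : SeqOfRecord F ν M g K k)
    (U : GaugeField (F.P K) 0 (SU N)) (j : ℕ) (idx : Pt (F.P K).d) (A : PBond (F.P K) 0 → MatA N) (hk : j ≤ (F.P K).m + (F.P K).K)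
    (w : GaugeTransf (F.P K) 0 (SU N)) (hw : IsResidual j w)
    (hax : ∀ i < j, AxialGauge (radialContourData (F.P K) i (SU N)) (Averaging.iter (avOfRecord F N K) i (gaugeAct w U)))
    (Vt : (i : ℕ) → Site (F.P K) i → (Matrix (Fin N) (Fin N) ℂ)ˣ) (hVt0 : ∀ x, Vt 0 x = 1)
    (hVts : ∀ (i : ℕ) (y : Site (F.P K) (i + 1)), Vt (i + 1) y = Vt i (emb y) *
      vframeU (dbarIterU i (unitsField (toUField (gaugeAct (fun x => blockLift j (axialGaugeAt (Averaging.iter (avOfRecord F N K) j (gaugeAct w U))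
        (tLo (cornerP (F.P K) Mc ρ idx) ρ) (tHi (cornerP (F.P K) Mc ρ idx) (sideP (F.P K) Mc ρ) ρ) (ctr (cornerP (F.P K) Mc ρ idx) (sideP (F.P K) Mc ρ))) x * w x) U)))) y)
    (sL : (i : ℕ) → Site (F.P K) i → SU N)
    (hsL : ∀ (i : ℕ) (y : Site (F.P K) i),
      (domainsMeet (cubeDomains (F.P K) (cornerP (F.P K) Mc ρ idx - ((ρ : ℕ) : Pt (F.P K).d)) (sideP (F.P K) Mc ρ + 2 * ρ) ρ j hk) (domainsOfSeq s.Ω j hk)).LamSite i y → toUT (sL i) y = Vt i y) :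
    ∃ u : GaugeTransf (F.P K) 0 (SU N), NrmDbarWideOfRecord F N Mc ρ ν M g K k s U j idx u A := by
  obtain ⟨g', hg'⟩ := exists_cellConst_gauge (domainsMeet (cubeDomains (F.P K) (cornerP (F.P K) Mc ρ idx - ((ρ : ℕ) : Pt (F.P K).d)) (sideP (F.P K) Mc ρ + 2 * ρ) ρ j hk) (domainsOfSeq s.Ω j hk)) sL
  refine ⟨fun x => g' x * (blockLift j (axialGaugeAt (Averaging.iter (avOfRecord F N K) j (gaugeAct w U))
      (tLo (cornerP (F.P K) Mc ρ idx) ρ) (tHi (cornerP (F.P K) Mc ρ idx) (sideP (F.P K) Mc ρ) ρ) (ctr (cornerP (F.P K) Mc ρ idx) (sideP (F.P K) Mc ρ))) x * w x),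
    w, hw, hax, ?_⟩
  intro hk' V hV0 hVs j' hj' y hy
  exact clause_of_cellConst (domainsMeet (cubeDomains (F.P K) (cornerP (F.P K) Mc ρ idx - ((ρ : ℕ) : Pt (F.P K).d)) (sideP (F.P K) Mc ρ + 2 * ρ) ρ j hk) (domainsOfSeq s.Ω j hk)) U _ g' Vt hVt0 hVts sL hsL hg'
    V hV0 hVs j' y hy

/-- ★★★ **(C1) FROM SPECIAL-UNITARITY OF THE FRAMES ON THE `Ω̃`-BLOCKS**: as `exists_of_frameLift`, the lift supplied by `exists_frameLift_of_framesSU` from «`vframeU (X̿^{(i)}) z ∈ SU(N)` at every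
`z ∈ Ω″_{i+1}`, `i+1 ≤ k″`», `X = (U^{h̄·w})♮`, `Ṽ` ANY family of accumulated frames of `X`. [cite: Balaban1985Averaging, (97) p.32; Balaban1987RG1, (0.9), (0.11) p.253; Balaban1985Variational, (150)–(154) pp.301–302] -/
theorem NrmDbarWideOfRecord.exists_of_framesSU {Mc ρ : ℕ} {ν : Stage7Numerics} {M : ℕ} {g : ℕ → ℝ} {K k : ℕ} (s : SeqOfRecord F ν M g K k)
    (U : GaugeField (F.P K) 0 (SU N)) (j : ℕ) (idx : Pt (F.P K).d) (A : PBond (F.P K) 0 → MatA N) (hk : j ≤ (F.P K).m + (F.P K).K)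
    (w : GaugeTransf (F.P K) 0 (SU N)) (hw : IsResidual j w)
    (hax : ∀ i < j, AxialGauge (radialContourData (F.P K) i (SU N)) (Averaging.iter (avOfRecord F N K) i (gaugeAct w U)))
    (Vt : (i : ℕ) → Site (F.P K) i → (Matrix (Fin N) (Fin N) ℂ)ˣ) (hVt0 : ∀ x, Vt 0 x = 1)
    (hVts : ∀ (i : ℕ) (y : Site (F.P K) (i + 1)), Vt (i + 1) y = Vt i (emb y) *
      vframeU (dbarIterU i (unitsField (toUField (gaugeAct (fun x => blockLift j (axialGaugeAt (Averaging.iter (avOfRecord F N K) j (gaugeAct w U))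
        (tLo (cornerP (F.P K) Mc ρ idx) ρ) (tHi (cornerP (F.P K) Mc ρ idx) (sideP (F.P K) Mc ρ) ρ) (ctr (cornerP (F.P K) Mc ρ idx) (sideP (F.P K) Mc ρ))) x * w x) U)))) y)
    (hsu : ∀ (i : ℕ) (z : Site (F.P K) (i + 1)),
      i + 1 ≤ (domainsMeet (cubeDomains (F.P K) (cornerP (F.P K) Mc ρ idx - ((ρ : ℕ) : Pt (F.P K).d)) (sideP (F.P K) Mc ρ + 2 * ρ) ρ j hk) (domainsOfSeq s.Ω j hk)).k →
      z ∈ (domainsMeet (cubeDomains (F.P K) (cornerP (F.P K) Mc ρ idx - ((ρ : ℕ) : Pt (F.P K).d)) (sideP (F.P K) Mc ρ + 2 * ρ) ρ j hk) (domainsOfSeq s.Ω j hk)).Om (i + 1) →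
      ∃ s' : Matrix.specialUnitaryGroup (Fin N) ℂ, (s' : Matrix (Fin N) (Fin N) ℂ) =
        ((vframeU (dbarIterU i (unitsField (toUField (gaugeAct (fun x => blockLift j (axialGaugeAt (Averaging.iter (avOfRecord F N K) j (gaugeAct w U))
          (tLo (cornerP (F.P K) Mc ρ idx) ρ) (tHi (cornerP (F.P K) Mc ρ idx) (sideP (F.P K) Mc ρ) ρ) (ctr (cornerP (F.P K) Mc ρ idx) (sideP (F.P K) Mc ρ))) x * w x) U)))) z :
          (Matrix (Fin N) (Fin N) ℂ)ˣ) : Matrix (Fin N) (Fin N) ℂ)) :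
    ∃ u : GaugeTransf (F.P K) 0 (SU N), NrmDbarWideOfRecord F N Mc ρ ν M g K k s U j idx u A := by
  obtain ⟨sL, hsL⟩ := exists_frameLift_of_framesSU _ _ Vt hVt0 hVts hsu
  exact NrmDbarWideOfRecord.exists_of_frameLift s U j idx A hk w hw hax Vt hVt0 hVts sL fun i y hy => hsL i y (Domains.le_of_lamSite _ hy) hy.1

/-- ★★★ **(C2) `NrmDbarWideOfRecord` IS INHABITED INSIDE THE SMALL-FIELD GUARD**: as `exists_of_framesSU`, the special-unitarity of the frames DISCHARGED by k0-s1-w1's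
★★`K0Stub1DoubleBarFramesSU.suN_vframeU_dbarIterU` from the near-flatness reads of `X = (U^{h̄·w})♮` on the fine bonds under every block `z ∈ Ω″_{i+1}` (`‖X(b) − 1‖ ≤ s₀`) with the
budgets `8·3800·ℓ²·L^{i+1}·s₀ ≤ 1` and `8ℓ·L^{i+1}·s₀ ≤ θ < δ_N` (`ℓ = (d+2)L`; `X` is `SU(N)`-valued by construction).
[cite: Balaban1987RG1, (0.9), (0.11) p.253; Balaban1985Averaging, (97) p.32, (110) p.34, Prop. 4 (134)–(135) p.38; Balaban1985Variational, (150)–(154) pp.301–302] -/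
theorem NrmDbarWideOfRecord.exists_of_reads {Mc ρ : ℕ} {ν : Stage7Numerics} {M : ℕ} {g : ℕ → ℝ} {K k : ℕ} (s : SeqOfRecord F ν M g K k)
    (U : GaugeField (F.P K) 0 (SU N)) (j : ℕ) (idx : Pt (F.P K).d) (A : PBond (F.P K) 0 → MatA N) (hk : j ≤ (F.P K).m + (F.P K).K)
    (w : GaugeTransf (F.P K) 0 (SU N)) (hw : IsResidual j w)
    (hax : ∀ i < j, AxialGauge (radialContourData (F.P K) i (SU N)) (Averaging.iter (avOfRecord F N K) i (gaugeAct w U)))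
    (Vt : (i : ℕ) → Site (F.P K) i → (Matrix (Fin N) (Fin N) ℂ)ˣ) (hVt0 : ∀ x, Vt 0 x = 1)
    (hVts : ∀ (i : ℕ) (y : Site (F.P K) (i + 1)), Vt (i + 1) y = Vt i (emb y) *
      vframeU (dbarIterU i (unitsField (toUField (gaugeAct (fun x => blockLift j (axialGaugeAt (Averaging.iter (avOfRecord F N K) j (gaugeAct w U))
        (tLo (cornerP (F.P K) Mc ρ idx) ρ) (tHi (cornerP (F.P K) Mc ρ idx) (sideP (F.P K) Mc ρ) ρ) (ctr (cornerP (F.P K) Mc ρ idx) (sideP (F.P K) Mc ρ))) x * w x) U)))) y)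
    {s₀ θ : ℝ} (hs₀ : 0 ≤ s₀) (hθ : θ < deltaSU (Fin N))
    (hbudget : ∀ i : ℕ, i + 1 ≤ (domainsMeet (cubeDomains (F.P K) (cornerP (F.P K) Mc ρ idx - ((ρ : ℕ) : Pt (F.P K).d)) (sideP (F.P K) Mc ρ + 2 * ρ) ρ j hk) (domainsOfSeq s.Ω j hk)).k →
      8 * 3800 * ((((F.P K).d + 2) * (F.P K).L : ℕ) : ℝ) ^ 2 * ((F.P K).L : ℝ) ^ (i + 1) * s₀ ≤ 1)
    (hguard : ∀ i : ℕ, i + 1 ≤ (domainsMeet (cubeDomains (F.P K) (cornerP (F.P K) Mc ρ idx - ((ρ : ℕ) : Pt (F.P K).d)) (sideP (F.P K) Mc ρ + 2 * ρ) ρ j hk) (domainsOfSeq s.Ω j hk)).k →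
      8 * ((((F.P K).d + 2) * (F.P K).L : ℕ) : ℝ) * ((F.P K).L : ℝ) ^ (i + 1) * s₀ ≤ θ)
    (hreads : ∀ (i : ℕ) (z : Site (F.P K) (i + 1)),
      i + 1 ≤ (domainsMeet (cubeDomains (F.P K) (cornerP (F.P K) Mc ρ idx - ((ρ : ℕ) : Pt (F.P K).d)) (sideP (F.P K) Mc ρ + 2 * ρ) ρ j hk) (domainsOfSeq s.Ω j hk)).k →
      z ∈ (domainsMeet (cubeDomains (F.P K) (cornerP (F.P K) Mc ρ idx - ((ρ : ℕ) : Pt (F.P K).d)) (sideP (F.P K) Mc ρ + 2 * ρ) ρ j hk) (domainsOfSeq s.Ω j hk)).Om (i + 1) →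
      ∀ b : PBond (F.P K) 0, iterBlockOf (i + 1) b.src = z → iterBlockOf (i + 1) b.tgt = z →
        ‖((unitsField (toUField (gaugeAct (fun x => blockLift j (axialGaugeAt (Averaging.iter (avOfRecord F N K) j (gaugeAct w U))
          (tLo (cornerP (F.P K) Mc ρ idx) ρ) (tHi (cornerP (F.P K) Mc ρ idx) (sideP (F.P K) Mc ρ) ρ) (ctr (cornerP (F.P K) Mc ρ idx) (sideP (F.P K) Mc ρ))) x * w x) U)) b :
          (Matrix (Fin N) (Fin N) ℂ)ˣ) : Matrix (Fin N) (Fin N) ℂ) - 1‖ ≤ s₀) :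
    ∃ u : GaugeTransf (F.P K) 0 (SU N), NrmDbarWideOfRecord F N Mc ρ ν M g K k s U j idx u A := by
  refine NrmDbarWideOfRecord.exists_of_framesSU s U j idx A hk w hw hax Vt hVt0 hVts fun i z hi hz => ?_
  have hi' : i + 1 ≤ (F.P K).m + (F.P K).K := hi.trans (Domains.hk _)
  exact suN_vframeU_dbarIterU hi' z _ hs₀ hθ (hbudget i hi) (hguard i hi) (hreads i z hi hz) fun b _ _ => suN_unitsField_toUField _ b

end Record

end Summit.QuantumFields.YangMills.BalabanUVNodes.N07NormalisationDbarFramesWideExists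

end
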